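import Mathlib
import HarnessLib
import Summits.HubbardSuperconductivity.HubbardSuperconductivity.Theorems.KLProgrammeKLRegimeSectorSliceDefectRowsFat
import Summits.HubbardSuperconductivity.HubbardSuperconductivity.Theorems.KLProgrammeKLRegimeSectorSliceDefectAmpTwoScale
import Summits.HubbardSuperconductivity.HubbardSuperconductivity.Theorems.KLProgrammeKLRegimeSplitFlowPieceOscJets

/-!
# Route `KLProgramme` — crux K3 ENGINE (stmt-HubbardSuperconductivity-20437) stub (b) conj. 2 «(c-D)² FAMILY TELESCOPE», brick (D5h†): the COVARIANCE
# piece of the simultaneous telescope at one flow piece, TELESCOPE form (reference scale `x₀ ≤ x`, weight `1 ≤ D_w·x`, `Λ_{nw}β/(2M) ≤ D_w·x·s₀`) — `klScaleWt`-rows/columns of `S(F̃^{K})ᵀ(C^{K′} − C^{K})S(F̃^{K})` when `e_{K′} − e_K` is the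
# mean-free flow piece `i` (`x = 4^i`), weight scale dominated with `D = D_w·x` asking only `1 ≤ D_w·x`, `Λ_{nw}β/(2M) ≤ D_w·x·s₀`, `Λ_{nw} ≤ D_w·ρ` (`…CovDefectPieceSharp` asked the
# x-free `Λ_{nw}β/(2M) ≤ D_w·s₀`), all closed data taken at the REFERENCE scale `x₀` (increment `G₀/x₀², G₁/x₀, G₂, G₃x₀`,
# rates `ρ/x₀, ρ₃/x₀`, third band datum `K₃♯x₀`, `a₃♯x₀`): an `x`-FREE bound, NO threshold conditions

Cell `gate-hubbard-kl`, seat hubbard-kl-k3c3-p2 (g11); F1-DESIGN §10.  k3c4-p2's `rowSumWt/colSumWt_sliceCT_sub_bgmFat_le` (`…SectorSliceDefectRowsFat`, fat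
family on the base frame `K`, ANY positive rates, closed amplitude `A₀^Δ`) at the rates `s₁ = ρ/x`, `s₂ = s₃′ = ρ/(x(N_r−1))`, `s₃ = ρ₃/(x(N_r−1))`, with
the increment data of the piece (`FlowPieceOscAt.pieceClause`: `P₀ = G₀/x²`, `P₁ = G₁/x`, `P₂ = G₂`, `P₃ = G₃x`), in the ratio `u = x/x₀ ≥ 1`:
`√W ≤ u·√Ŵ(x₀)` and `A₀^Δ(x) ≤ A₀^♯(x₀)/u²` (`sliceDefect_amp_twoScale_le`, `…SectorSliceDefectAmpTwoScale`, at `u`); the companion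
`…EngineSliceCovDefectPiece` is the case `x₀ = 1`, `1 ≤ D_w`:

* **`rowSumWt_sliceCT_covDefect_pieceTel_le`** — rows/columns `≤ 8·(9·(D_w x₀·(√Ŵ(x₀)·√(24·2M·L²·N̄_s)·A₀^♯(x₀))))` (`u` cancelled).

Everything is proved; no definitions, no sorry.  Nothing asserts superconductivity. [cite: BenfattoGiulianiMastropietro2006, §2.8 (2.81), §3 (3.2)–(3.8)]
-/

noncomputable section

namespace Summit.HubbardSuperconductivity.HubbardSuperconductivity.Theorems.TorusFourierL2

set_option linter.dupNamespace false -- summit = problem name (single-conjunct summit), D-0017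

open Set Finset Literature.MathematicalPhysics.QuantumLattice Literature.MathematicalPhysics.QuantumLattice.BandSectorCounting
open Literature.MathematicalPhysics.QuantumLattice.FermiRG Literature.Probability.LatticeModels Literature.Analysis.SpecialFunctions
open Summit.HubbardSuperconductivity.HubbardSuperconductivity.Theorems.DispersionFlow
open Summit.HubbardSuperconductivity.HubbardSuperconductivity.Theorems.KLRegimeSplit
open Summit.HubbardSuperconductivity.HubbardSuperconductivity.Theorems.KLProgrammeLegKernels
open Summit.HubbardSuperconductivity.HubbardSuperconductivity.Theorems.PerturbedFermiCurve
open Summit.HubbardSuperconductivity.HubbardSuperconductivity.Theorems.EngineV8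
open scoped Real Nat

section CovPieceTel

open Classical

variable {L M : ℕ} [NeZero L] [NeZero M] {a b : ℝ} (B : BandBounds a b) {K K' : TrigPolyC4v} {A x x₀ : ℝ} (hx₀ : 1 ≤ x₀) (hx₀x : x₀ ≤ x)
  (hA : ∀ p : Momentum, ∀ j ≤ 2, ‖iteratedFDeriv ℝ j (frameShift K) p‖ ≤ A) (hADt : 2 * A < B.Dtmin)
  {μ e₀ z β : ℝ} (he : 0 < e₀) (hz : 0 < z) (hz1 : z ≤ 1) (hgap : e₀ + A + z ^ 2 < -μ) (h3 : e₀ + A - μ ≤ 3)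
  (hlo : a ≤ μ - A - e₀) (hhi : μ + A + e₀ ≤ b) (hβ : 0 < β) (hρA : 4 * A < 2 * B.rhomin)
  (m : ℕ) (hMm : klScale e₀ m * β < π * (2 * M - 5))
  {d : ℝ} (hd : 0 ≤ d) (hd1 : ∀ u, |deriv (bgmCutoffSq e₀) u| ≤ d) (hd2 : ∀ u, |iteratedDeriv 2 (bgmCutoffSq e₀) u| ≤ d)
  (hd3 : ∀ u, |iteratedDeriv 3 (bgmCutoffSq e₀) u| ≤ d)
  {A₃ a₃s : ℝ} (hA3 : ∀ p : Momentum, ‖iteratedFDeriv ℝ 3 (frameShift K) p‖ ≤ A₃) (ha3 : A₃ * klScale e₀ m ^ 2 ≤ a₃s * x) (ha3s : 0 ≤ a₃s)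
  {Ba : ℝ} (hB0 : 0 ≤ Ba)
  (hB : ∀ (i : ℕ), i ≤ 2 → ∀ (n : ℕ) (ω : ℤ) (θ₀ : ℝ) (q w : Fin 2 → ℝ) (t : ℝ) {r₀ : ℝ}, 0 < r₀ →
    r₀ ≤ ‖momToComplex (q + t • w)‖ → |sectorRelAngle θ₀ (q + t • w)| < π →
    ‖iteratedDeriv i (fun t : ℝ => sectorWeightCirc n ω (polarAngle (q + t • w))) t‖ ≤
      (2 : ℕ)! * Ba * ((1 + (sectorWidth n)⁻¹ * (2 : ℕ)!) * ‖momToComplex w‖ / r₀) ^ i)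
  {Ba3 : ℝ} (hB30 : 0 ≤ Ba3)
  (hB3 : ∀ (i : ℕ), i ≤ 3 → ∀ (n : ℕ) (ω : ℤ) (θ₀ : ℝ) (q w : Fin 2 → ℝ) (t : ℝ) {r₀ : ℝ}, 0 < r₀ →
    r₀ ≤ ‖momToComplex (q + t • w)‖ → |sectorRelAngle θ₀ (q + t • w)| < π →
    ‖iteratedDeriv i (fun t : ℝ => sectorWeightCirc n ω (polarAngle (q + t • w))) t‖ ≤
      (3 : ℕ)! * Ba3 * ((1 + (sectorWidth n)⁻¹ * (3 : ℕ)!) * ‖momToComplex w‖ / r₀) ^ i)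
  -- the slice and the Euclidean frame data of the propagator side (frame `K`)
  {Λ Λ' : ℝ} (hΛ : 0 < Λ) (hΛΛ' : Λ ≤ Λ') (hM' : Λ' < π * (2 * M - 5) / β)
  {K₁ K₂ K₃s : ℝ} (hK₁ : ∀ p, ‖fderiv ℝ (frameLevel μ K) p‖ ≤ K₁) (hK₂ : ∀ p, ‖iteratedFDeriv ℝ 2 (frameLevel μ K) p‖ ≤ K₂)
  (hK₃ : ∀ p, ‖iteratedFDeriv ℝ 3 (frameLevel μ K) p‖ ≤ K₃s * x) (hK₃s : 0 ≤ K₃s)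
  {B₁ B₂ B₃ B₄ : ℝ} (hB₁ : ∀ x, |deriv salmhoferCutoff x| ≤ B₁) (hB₂ : ∀ x, |deriv (deriv salmhoferCutoff) x| ≤ B₂)
  (hB₃ : ∀ x, |deriv (deriv (deriv salmhoferCutoff)) x| ≤ B₃) (hB₄ : ∀ x, |deriv (deriv (deriv (deriv salmhoferCutoff))) x| ≤ B₄)
  -- the band increment `e_{K′} − e_K`: the mean-free flow piece `i` (`x = 4^i`)
  {U c'' : ℝ} {R : RenConsts} {i : ℕ} (hR : ∀ j, 0 ≤ R.Gfr j) (hc'' : 0 ≤ c'') (hxi : x = (4 : ℝ) ^ i)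
  (hJ : FlowPieceJetsAt L M β U μ R i) (hO : FlowPieceOscAt L M c'' β U μ i)
  (hinc : (fun q : Momentum => frameLevel μ K' q - frameLevel μ K q) =
    fun q => evalM (klFlowPiece L M β U μ i) q - klAngularMean (klLocalPart L M β U μ (klFlowFrameU L M β U μ i) i))
  {G₀ Gi₁ Gi₂ Gi₃ : ℝ} (hG₀ : G₀ = c'' * |U| * uPow 0 U) (hGi₁ : Gi₁ = R.Gfr 1 * uPow 1 U) (hGi₂ : Gi₂ = R.Gfr 2 * uPow 2 U) (hGi₃ : Gi₃ = R.Gfr 3 * uPow 3 U)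
  -- tangent resolution, zone margin for the steps, far-region radius
  {Nr : ℝ} (hNr : 2 ≤ Nr) (hLz : 3 * |2 * π / L| * (Nr + 1 / 2) ≤ z) {R₀ : ℕ} (hR₀ : 2 * (2 * Nr + 1) * (R₀ : ℝ) < L)
  -- abbreviations (instantiate with `rfl`)
  {ℓ₁ ℓ ρf G₁ G₂ G₃ Kp wsi τt Ae1 Ae2 An1 An2 Av1 Av2 : ℝ}
  (hℓ₁ : ℓ₁ = 2 * π / L) (hℓ : ℓ = 2 * π / L * (Nr + 1 / 2))
  (hρf : ρf = (klScale e₀ m + B.smax * B.Dtmin * (3 * sectorWidth (m + 1) / 4)) / (B.Dtmin - 2 * A) +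
    π * Real.sqrt 2 * (1 + (4 + 2 * A) / (B.Dtmin - 2 * A)) * sectorWidth (m + 1))
  (hG₁ : G₁ = d * e₀ ^ 2 * 1 + 1 * (d * e₀ ^ 2)) (hG₂ : G₂ = d * e₀ ^ 4 * 1 + 2 * (d * e₀ ^ 2) * (d * e₀ ^ 2) + 1 * (d * e₀ ^ 4))
  (hG₃ : G₃ = d * e₀ ^ 6 * 1 + 3 * (d * e₀ ^ 4) * (d * e₀ ^ 2) + 3 * (d * e₀ ^ 2) * (d * e₀ ^ 4) + 1 * (d * e₀ ^ 6))
  (hKp : Kp = 4 + 4 * A) (hwsi : wsi = (sectorWidth (m + 1))⁻¹)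
  (hτt : τt = |2 * π / L| * (4 + 2 * A) + K₂ * (Real.sqrt 2 * ρf) * (Real.sqrt 2 * ℓ))
  (hAe1 : Ae1 = 2 * G₁ * ((4 + 2 * A) * ℓ₁ + Kp * (ρf + 2 * ℓ₁) * ℓ₁) / klScale e₀ m * 1 + 1 * 1 * (9 * (4 * Ba * ((1 + 2 * wsi) * (2 * ℓ₁)))))
  (hAe2 : Ae2 = ((4 * G₂ + 2 * G₁) * ((4 + 2 * A) * ℓ₁ + Kp * (ρf + 2 * ℓ₁) * ℓ₁) ^ 2 / klScale e₀ m ^ 2 + 2 * G₁ * (Kp * ℓ₁ ^ 2) / klScale e₀ m) * 1 +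
    4 * G₁ * ((4 + 2 * A) * ℓ₁ + Kp * (ρf + 2 * ℓ₁) * ℓ₁) / klScale e₀ m * (9 * (4 * Ba * ((1 + 2 * wsi) * (2 * ℓ₁)))) +
    1 * 1 * (9 * (4 * Ba * ((1 + 2 * wsi) * (2 * ℓ₁)) ^ 2 + 8 * Ba ^ 2 * ((1 + 2 * wsi) * (2 * ℓ₁)) ^ 2)))
  (hAn1 : An1 = 2 * G₁ * ((4 + 2 * A) * ℓ + Kp * (ρf + 2 * ℓ) * ℓ) / klScale e₀ m * 1 + 1 * 1 * (9 * (4 * Ba * ((1 + 2 * wsi) * (2 * ℓ)))))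
  (hAn2 : An2 = ((4 * G₂ + 2 * G₁) * ((4 + 2 * A) * ℓ + Kp * (ρf + 2 * ℓ) * ℓ) ^ 2 / klScale e₀ m ^ 2 + 2 * G₁ * (Kp * ℓ ^ 2) / klScale e₀ m) * 1 +
    4 * G₁ * ((4 + 2 * A) * ℓ + Kp * (ρf + 2 * ℓ) * ℓ) / klScale e₀ m * (9 * (4 * Ba * ((1 + 2 * wsi) * (2 * ℓ)))) +
    1 * 1 * (9 * (4 * Ba * ((1 + 2 * wsi) * (2 * ℓ)) ^ 2 + 8 * Ba ^ 2 * ((1 + 2 * wsi) * (2 * ℓ)) ^ 2)))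
  (hAv1 : Av1 = 2 * G₁ * (|2 * π / L| * (4 + 2 * A) + Kp * (ρf + 2 * ℓ) * ℓ) / klScale e₀ m * 1 + 1 * 1 * (9 * (4 * Ba * ((1 + 2 * wsi) * (2 * ℓ)))))
  (hAv2 : Av2 = ((4 * G₂ + 2 * G₁) * (|2 * π / L| * (4 + 2 * A) + Kp * (ρf + 2 * ℓ) * ℓ) ^ 2 / klScale e₀ m ^ 2 + 2 * G₁ * (Kp * ℓ ^ 2) / klScale e₀ m) * 1 +
    4 * G₁ * (|2 * π / L| * (4 + 2 * A) + Kp * (ρf + 2 * ℓ) * ℓ) / klScale e₀ m * (9 * (4 * Ba * ((1 + 2 * wsi) * (2 * ℓ)))) +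
    1 * 1 * (9 * (4 * Ba * ((1 + 2 * wsi) * (2 * ℓ)) ^ 2 + 8 * Ba ^ 2 * ((1 + 2 * wsi) * (2 * ℓ)) ^ 2)))
  -- the defect polynomials and time amplitude AT THE REFERENCE SCALE `x₀` (instantiate with `rfl`)
  {X₀s X₁s X₂s X₃s Tts : ℝ}
  (hX₀s : X₀s = (16 * B₁ + 16) * (β * (L : ℝ) ^ 2) / Λ ^ 2 * (G₀ / x₀ ^ 2))
  (hX₁s : X₁s = (32 * B₂ + 144 * B₁ + 128) * (β * (L : ℝ) ^ 2) / Λ ^ 3 * (G₀ / x₀ ^ 2) * (K₁ + (Gi₁ / x₀)) + (16 * B₁ + 16) * (β * (L : ℝ) ^ 2) / Λ ^ 2 * (Gi₁ / x₀))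
  (hX₂s : X₂s = (64 * B₃ + 480 * B₂ + 1728 * B₁ + 1536) * (β * (L : ℝ) ^ 2) / Λ ^ 4 * (G₀ / x₀ ^ 2) * (K₁ + (Gi₁ / x₀)) ^ 2 +
    (32 * B₂ + 144 * B₁ + 128) * (β * (L : ℝ) ^ 2) / Λ ^ 3 * ((Gi₁ / x₀) * (2 * K₁ + (Gi₁ / x₀))) +
    ((32 * B₂ + 144 * B₁ + 128) * (β * (L : ℝ) ^ 2) / Λ ^ 3 * (G₀ / x₀ ^ 2) * (K₂ + Gi₂) + (16 * B₁ + 16) * (β * (L : ℝ) ^ 2) / Λ ^ 2 * Gi₂))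
  (hX₃s : X₃s = (128 * B₄ + 1408 * B₃ + 7776 * B₂ + 27648 * B₁ + 24576) * (β * (L : ℝ) ^ 2) / Λ ^ 5 * (G₀ / x₀ ^ 2) * (K₁ + (Gi₁ / x₀)) ^ 3 +
    (64 * B₃ + 480 * B₂ + 1728 * B₁ + 1536) * (β * (L : ℝ) ^ 2) / Λ ^ 4 * ((Gi₁ / x₀) * (3 * K₁ ^ 2 + 3 * K₁ * (Gi₁ / x₀) + (Gi₁ / x₀) ^ 2)) +
    3 * ((64 * B₃ + 480 * B₂ + 1728 * B₁ + 1536) * (β * (L : ℝ) ^ 2) / Λ ^ 4 * (G₀ / x₀ ^ 2) * ((K₁ + (Gi₁ / x₀)) * (K₂ + Gi₂)) +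
      (32 * B₂ + 144 * B₁ + 128) * (β * (L : ℝ) ^ 2) / Λ ^ 3 * (K₁ * Gi₂ + (Gi₁ / x₀) * K₂ + (Gi₁ / x₀) * Gi₂)) +
    ((32 * B₂ + 144 * B₁ + 128) * (β * (L : ℝ) ^ 2) / Λ ^ 3 * (G₀ / x₀ ^ 2) * ((K₃s * x₀) + (Gi₃ * x₀)) + (16 * B₁ + 16) * (β * (L : ℝ) ^ 2) / Λ ^ 2 * (Gi₃ * x₀)))
  (hTts : Tts = (1 / (β * (L : ℝ) ^ 2)) ^ 2 *
    (1 * ((2 * π / β) ^ 3 * ((128 * B₄ + 1216 * B₃ + 6912 * B₂ + 26112 * B₁ + 24576) * (β * (L : ℝ) ^ 2) / Λ ^ 5 * (G₀ / x₀ ^ 2))) +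
      3 * ((2 * G₁ * |2 * π / β| * 1 / klScale e₀ m) * ((2 * π / β) ^ 2 * ((64 * B₃ + 416 * B₂ + 1600 * B₁ + 1536) * (β * (L : ℝ) ^ 2) / Λ ^ 4 * (G₀ / x₀ ^ 2)))) +
      3 * (((4 * G₂ + 2 * G₁) * (2 * π / β) ^ 2 * 1 / klScale e₀ m ^ 2) * ((2 * π / β) * ((32 * B₂ + 128 * B₁ + 128) * (β * (L : ℝ) ^ 2) / Λ ^ 3 * (G₀ / x₀ ^ 2)))) +
      ((8 * G₃ + 12 * G₂) * |2 * π / β| ^ 3 * 1 / klScale e₀ m ^ 3) * ((16 * B₁ + 16) * (β * (L : ℝ) ^ 2) / Λ ^ 2 * (G₀ / x₀ ^ 2))))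

  -- the rates and the closed amplitude at the reference scale (instantiate with `rfl`)
  {s₀ ρ ρ₃ : ℝ} (hs₀ : 0 < s₀) (hρ : 0 < ρ) (hρ₃ : 0 < ρ₃)
  {κA κB AΔs : ℝ}
  (hκA : κA = (8 * G₃ + 12 * G₂) * (4 + 2 * A) ^ 3 + (12 * G₂ + 6 * G₁) * (4 + 2 * A) * (4 + 4 * A) * e₀ + 2 * G₁ * (4 * e₀ ^ 2) +
      216 * 9 * Ba3 * ((4 * G₂ + 2 * G₁) * (4 + 2 * A) ^ 2 * (2 * e₀) + 2 * G₁ * (4 + 4 * A) * e₀ * (2 * e₀)) +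
      216 * 9 * G₁ * (4 + 2 * A) * (12 * Ba3 + 72 * Ba3 ^ 2) * (2 * e₀) ^ 2 + 216 * 9 * (12 * Ba3 + 216 * Ba3 ^ 2) * (2 * e₀) ^ 3)
  (hκB : κB = 2 * G₁ * (8 * (a₃s * x₀)))
  (hAΔs : AΔs = (1 / (β * (L : ℝ) ^ 2)) ^ 2 * X₀s + Tts / (4 / (s₀ * (2 * M : ℕ))) ^ 3 +
      (1 / (β * (L : ℝ) ^ 2)) ^ 2 * ((Real.sqrt 2 * ℓ₁) ^ 3 * X₃s + 3 * (Ae1 * ((Real.sqrt 2 * ℓ₁) ^ 2 * X₂s)) +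
        3 * (Ae2 * ((Real.sqrt 2 * ℓ₁) * X₁s)) + (κA + κB) * ℓ₁ ^ 3 / klScale e₀ m ^ 3 * X₀s) / (4 / (ρ / x₀ * L)) ^ 3 +
      (1 / (β * (L : ℝ) ^ 2)) ^ 2 * ((Real.sqrt 2 * ℓ) ^ 3 * X₃s + 3 * (An1 * ((Real.sqrt 2 * ℓ) ^ 2 * X₂s)) +
        3 * (An2 * ((Real.sqrt 2 * ℓ) * X₁s)) + (κA + κB) * ℓ ^ 3 / klScale e₀ m ^ 3 * X₀s) / (4 / (ρ / x₀ / (Nr - 1) * L)) ^ 3 +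
      (1 / (β * (L : ℝ) ^ 2)) ^ 2 * ((Real.sqrt 2 * ℓ) ^ 2 * X₂s + 2 * (Av1 * ((Real.sqrt 2 * ℓ) * X₁s)) + Av2 * X₀s) / (4 / (ρ₃ / x₀ / (Nr - 1) * L)) ^ 2 +
      (1 / (β * (L : ℝ) ^ 2)) ^ 2 * ((Real.sqrt 2 * ℓ) ^ 3 * X₃s + 3 * (Av1 * ((Real.sqrt 2 * ℓ) ^ 2 * X₂s)) +
        3 * (Av2 * ((Real.sqrt 2 * ℓ) * X₁s)) + (κA + κB) * ℓ ^ 3 / klScale e₀ m ^ 3 * X₀s) / (4 / (ρ / x₀ / (Nr - 1) * L)) ^ 3)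

include B hx₀ hx₀x hA hADt he hz hz1 hgap h3 hlo hhi hβ hρA hMm hd hd1 hd2 hd3 hA3 ha3 ha3s hB0 hB hB30 hB3 hΛ hΛΛ' hM' hK₁ hK₂ hK₃ hK₃s hB₁ hB₂ hB₃ hB₄
  hR hc'' hxi hJ hO hinc hG₀ hGi₁ hGi₂ hGi₃ hNr hLz hR₀ hℓ₁ hℓ hρf hG₁ hG₂ hG₃ hKp hwsi hτt hAe1 hAe2 hAn1 hAn2 hAv1 hAv2 hX₀s hX₁s hX₂s hX₃s hTts hs₀ hρ hρ₃ hκA hκB hAΔs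

set_option maxHeartbeats 4000000 in
/-- **The covariance piece of the simultaneous telescope at one flow piece, telescope form at the reference scale `x₀`** (see the module docstring).
[cite: BenfattoGiulianiMastropietro2006, §2.8 (2.81), §3 (3.2)–(3.8)] -/
theorem rowSumWt_sliceCT_covDefect_pieceTel_le (nw : ℕ) {Dw : ℝ} (hDw : 1 ≤ Dw * x) (hdom₀ : klScale klE0 nw * β / (2 * M) ≤ Dw * x * s₀)
    (hdom₁ : klScale klE0 nw ≤ Dw * ρ) :
    (∀ Y : SpaceTimeIdx L M × SectorLeg (sectorCount (m + 1)),
      ∑ Y' : SpaceTimeIdx L M × SectorLeg (sectorCount (m + 1)),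
        ‖((sectorSubMatrix L M β (bgmFatMultiplier L M e₀ β (nambuXiCT L μ K) (m + 1))).transpose *
            (hubbardCovSliceCT L M β μ 0 K' Λ Λ' - hubbardCovSliceCT L M β μ 0 K Λ Λ') *
            sectorSubMatrix L M β (bgmFatMultiplier L M e₀ β (nambuXiCT L μ K) (m + 1))) Y Y'‖ *
          klScaleWt L M β nw {latticeLegPos (2 * (2 * M)) Y, latticeLegPos (2 * (2 * M)) Y'} ≤
      8 * ((9 : ℕ) * (Dw * x₀ * (Real.sqrt (524288 * (1 / s₀ + 1) * ((1 + 4 * Real.sqrt 2) ^ 2 * ((2 * Real.sqrt 2 / (ρ / x₀) + 2) * (2 * Real.sqrt 2 / (ρ₃ / x₀) + 2)) + (1 / (ρ / x₀) + 1) ^ 2)) *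
        Real.sqrt (24 * (2 * M : ℕ) * (L : ℝ) ^ 2 *
          ((klScale e₀ m * β / π + 1) *
            ((Real.sqrt 2 * L * ((klScale e₀ m + (4 + 4 * A) * ρf ^ 2) / (2 * B.rhomin - 4 * A)) / π + 2) *
              (Real.sqrt 2 * L * (2 * ρf) / π + 2)))) * AΔs)))) ∧
    (∀ Y' : SpaceTimeIdx L M × SectorLeg (sectorCount (m + 1)),
      ∑ Y : SpaceTimeIdx L M × SectorLeg (sectorCount (m + 1)),
        ‖((sectorSubMatrix L M β (bgmFatMultiplier L M e₀ β (nambuXiCT L μ K) (m + 1))).transpose *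
            (hubbardCovSliceCT L M β μ 0 K' Λ Λ' - hubbardCovSliceCT L M β μ 0 K Λ Λ') *
            sectorSubMatrix L M β (bgmFatMultiplier L M e₀ β (nambuXiCT L μ K) (m + 1))) Y Y'‖ *
          klScaleWt L M β nw {latticeLegPos (2 * (2 * M)) Y, latticeLegPos (2 * (2 * M)) Y'} ≤
      8 * ((9 : ℕ) * (Dw * x₀ * (Real.sqrt (524288 * (1 / s₀ + 1) * ((1 + 4 * Real.sqrt 2) ^ 2 * ((2 * Real.sqrt 2 / (ρ / x₀) + 2) * (2 * Real.sqrt 2 / (ρ₃ / x₀) + 2)) + (1 / (ρ / x₀) + 1) ^ 2)) *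
        Real.sqrt (24 * (2 * M : ℕ) * (L : ℝ) ^ 2 *
          ((klScale e₀ m * β / π + 1) *
            ((Real.sqrt 2 * L * ((klScale e₀ m + (4 + 4 * A) * ρf ^ 2) / (2 * B.rhomin - 4 * A)) / π + 2) *
              (Real.sqrt 2 * L * (2 * ρf) / π + 2)))) * AΔs)))) := by
  have hL : (0 : ℝ) < L := Nat.cast_pos.2 (Nat.pos_of_ne_zero (NeZero.ne L))
  have hπ := Real.pi_pos
  have hx : 1 ≤ x := hx₀.trans hx₀x
  have hx0 : 0 < x := lt_of_lt_of_le one_pos hx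
  have hx₀0 : 0 < x₀ := lt_of_lt_of_le one_pos hx₀
  have hNr1 : 0 < Nr - 1 := by linarith only [hNr]
  have hΛm : 0 < klScale e₀ m := by rw [klScale]; positivity
  have hu : ∀ j, 0 ≤ uPow j U := fun j => uPow_nonneg' j U
  have hDw0 : 0 ≤ Dw := ((pos_iff_pos_of_mul_pos (one_pos.trans_le hDw)).2 hx0).le
  -- the reference scale: `u = x/x₀ ≥ 1` and the data at `x₀`
  obtain ⟨u, hudef⟩ : ∃ y : ℝ, y = x / x₀ := ⟨_, rfl⟩
  have hu1 : 1 ≤ u := by rw [hudef, le_div_iff₀ hx₀0, one_mul]; exact hx₀x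
  have hu0 : 0 < u := lt_of_lt_of_le one_pos hu1
  have hxu : x = x₀ * u := by rw [hudef]; field_simp
  obtain ⟨G₀', hG₀'⟩ : ∃ y : ℝ, y = G₀ / x₀ ^ 2 := ⟨_, rfl⟩
  obtain ⟨Gi₁', hGi₁'⟩ : ∃ y : ℝ, y = Gi₁ / x₀ := ⟨_, rfl⟩
  obtain ⟨Gi₃', hGi₃'⟩ : ∃ y : ℝ, y = Gi₃ * x₀ := ⟨_, rfl⟩
  obtain ⟨K₃s', hK₃s'⟩ : ∃ y : ℝ, y = K₃s * x₀ := ⟨_, rfl⟩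
  obtain ⟨a₃s', ha₃s'⟩ : ∃ y : ℝ, y = a₃s * x₀ := ⟨_, rfl⟩
  obtain ⟨ρ', hρ'⟩ : ∃ y : ℝ, y = ρ / x₀ := ⟨_, rfl⟩
  obtain ⟨ρ₃', hρ₃'⟩ : ∃ y : ℝ, y = ρ₃ / x₀ := ⟨_, rfl⟩
  obtain ⟨Dw', hDw'⟩ : ∃ y : ℝ, y = Dw * x₀ := ⟨_, rfl⟩
  simp only [← hG₀', ← hGi₁', ← hGi₃', ← hK₃s'] at hX₀s hX₁s hX₂s hX₃s hTts
  simp only [← ha₃s'] at hκB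
  simp only [← hρ', ← hρ₃'] at hAΔs
  simp only [← hρ', ← hρ₃', ← hDw']
  have hG₀0 : 0 ≤ G₀' := by rw [hG₀', hG₀]; exact div_nonneg (mul_nonneg (mul_nonneg hc'' (abs_nonneg _)) (hu 0)) (by positivity)
  have hGi₁0 : 0 ≤ Gi₁' := by rw [hGi₁', hGi₁]; exact div_nonneg (mul_nonneg (hR 1) (hu 1)) hx₀0.le
  have hGi₂0 : 0 ≤ Gi₂ := by rw [hGi₂]; exact mul_nonneg (hR 2) (hu 2)
  have hGi₃0 : 0 ≤ Gi₃' := by rw [hGi₃', hGi₃]; exact mul_nonneg (mul_nonneg (hR 3) (hu 3)) hx₀0.le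
  have hK₃s0 : 0 ≤ K₃s' := by rw [hK₃s']; positivity
  have ha3s0 : 0 ≤ a₃s' := by rw [ha₃s']; positivity
  have hρ0 : 0 < ρ' := by rw [hρ']; positivity
  have hρ₃0 : 0 < ρ₃' := by rw [hρ₃']; positivity
  have hK₃u : ∀ p, ‖iteratedFDeriv ℝ 3 (frameLevel μ K) p‖ ≤ K₃s' * u := fun p => by rw [hK₃s', mul_assoc, ← hxu]; exact hK₃ p
  have ha3u : A₃ * klScale e₀ m ^ 2 ≤ a₃s' * u := by rw [ha₃s', mul_assoc, ← hxu]; exact ha3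
  -- the piece data
  have hP : ∀ j ≤ 4, ∀ q : Momentum, ‖iteratedFDeriv ℝ j (fun q : Momentum => frameLevel μ K' q - frameLevel μ K q) q‖ ≤
      (if j = 0 then c'' * |U| else R.Gfr j) * uPow j U * (4 : ℝ) ^ (((j : ℤ) - 2) * (i : ℤ)) := fun j hj q => by
    rw [hinc]; exact hO.pieceClause hJ hj q
  have e0 : (4 : ℝ) ^ (((0 : ℤ) - 2) * (i : ℤ)) = 1 / x ^ 2 := by
    rw [hxi, zero_sub, show (-2 : ℤ) * (i : ℤ) = -((i * 2 : ℕ) : ℤ) by push_cast; ring, zpow_neg, zpow_natCast, pow_mul, one_div]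
  have e1 : (4 : ℝ) ^ (((1 : ℤ) - 2) * (i : ℤ)) = 1 / x := by
    rw [hxi, show ((1 : ℤ) - 2) * (i : ℤ) = -(i : ℤ) by ring, zpow_neg, zpow_natCast, one_div]
  have e2 : (4 : ℝ) ^ (((2 : ℤ) - 2) * (i : ℤ)) = 1 := by rw [sub_self, zero_mul, zpow_zero]
  have e3 : (4 : ℝ) ^ (((3 : ℤ) - 2) * (i : ℤ)) = x := by
    rw [hxi, show ((3 : ℤ) - 2) * (i : ℤ) = (i : ℤ) by ring, zpow_natCast]
  have hv₀ : ∀ p : Momentum, |frameLevel μ K' p - frameLevel μ K p| ≤ G₀' / u ^ 2 := fun p => by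
    have h := hP 0 (by norm_num) p
    rw [norm_iteratedFDeriv_zero, Real.norm_eq_abs, if_pos rfl, Nat.cast_zero, e0] at h
    refine h.trans_eq ?_
    rw [hG₀', hG₀, hxu]; field_simp
  have hv₁ : ∀ p : Momentum, ‖fderiv ℝ (fun q : Momentum => frameLevel μ K' q - frameLevel μ K q) p‖ ≤ Gi₁' / u := fun p => by
    have h := hP 1 (by norm_num) p
    rw [norm_iteratedFDeriv_one, if_neg one_ne_zero, Nat.cast_one, e1] at h
    refine h.trans_eq ?_
    rw [hGi₁', hGi₁, hxu]; field_simp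
  have hv₂ : ∀ p : Momentum, ‖iteratedFDeriv ℝ 2 (fun q : Momentum => frameLevel μ K' q - frameLevel μ K q) p‖ ≤ Gi₂ := fun p => by
    have h := hP 2 (by norm_num) p
    rw [if_neg two_ne_zero, Nat.cast_ofNat, e2, mul_one] at h
    refine h.trans_eq ?_
    rw [hGi₂]
  have hv₃ : ∀ p : Momentum, ‖iteratedFDeriv ℝ 3 (fun q : Momentum => frameLevel μ K' q - frameLevel μ K q) p‖ ≤ Gi₃' * u := fun p => by
    have h := hP 3 (by norm_num) p
    rw [if_neg (by norm_num : (3 : ℕ) ≠ 0), Nat.cast_ofNat, e3] at h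
    refine h.trans_eq ?_
    rw [hGi₃', hGi₃, hxu]; ring
  -- k3c4-p2's closed defect rows at the solved rates
  have hκ₃F' : κA + κB * u = (8 * G₃ + 12 * G₂) * (4 + 2 * A) ^ 3 + (12 * G₂ + 6 * G₁) * (4 + 2 * A) * (4 + 4 * A) * e₀ +
      2 * G₁ * (4 * e₀ ^ 2 + 8 * (a₃s' * u)) +
      216 * 9 * Ba3 * ((4 * G₂ + 2 * G₁) * (4 + 2 * A) ^ 2 * (2 * e₀) + 2 * G₁ * (4 + 4 * A) * e₀ * (2 * e₀)) +
      216 * 9 * G₁ * (4 + 2 * A) * (12 * Ba3 + 72 * Ba3 ^ 2) * (2 * e₀) ^ 2 + 216 * 9 * (12 * Ba3 + 216 * Ba3 ^ 2) * (2 * e₀) ^ 3 := by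
    rw [hκA, hκB]; ring
  have hs₁ : 0 < ρ' / u := by positivity
  have hs₂ : 0 < ρ' / u / (Nr - 1) := by positivity
  have hs₃ : 0 < ρ₃' / u / (Nr - 1) := by positivity
  have hD : 1 ≤ Dw' * u := by rw [hDw', mul_assoc, ← hxu]; exact hDw
  have hDw'0 : 0 ≤ Dw' := by rw [hDw']; positivity
  have hdom₀' : klScale klE0 nw * β / (2 * M) ≤ Dw' * u * s₀ := by
    rw [hDw', show Dw * x₀ * u * s₀ = Dw * x * s₀ by rw [hxu]; ring]; exact hdom₀
  have hdom₁' : klScale klE0 nw ≤ Dw' * u * (ρ' / u) := by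
    rw [mul_assoc, mul_div_cancel₀ _ hu0.ne', hDw', hρ', show Dw * x₀ * (ρ / x₀) = Dw * ρ by field_simp]; exact hdom₁
  have hrows := fun Y => rowSumWt_sliceCT_sub_bgmFat_le B hA hADt he hz hz1 hgap h3 hlo hhi hβ hρA m hMm hd hd1 hd2 hd3 hA3 ha3u hB0 hB hB30 hB3 hΛ hΛΛ' hM' hK₁ hK₂ hK₃u
    hB₁ hB₂ hB₃ hB₄ hv₀ hv₁ hv₂ hv₃ hNr hLz hR₀ hℓ₁ hℓ hρf hG₁ hG₂ hG₃ hκ₃F' hKp hwsi hτt hAe1 hAe2 hAn1 hAn2 hAv1 hAv2 rfl rfl rfl rfl rfl hs₀ hs₁ hs₂ hs₃ hs₂ rfl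
    nw hD hdom₀' hdom₁' Y
  have hcols := fun Y' => colSumWt_sliceCT_sub_bgmFat_le B hA hADt he hz hz1 hgap h3 hlo hhi hβ hρA m hMm hd hd1 hd2 hd3 hA3 ha3u hB0 hB hB30 hB3 hΛ hΛΛ' hM' hK₁ hK₂ hK₃u
    hB₁ hB₂ hB₃ hB₄ hv₀ hv₁ hv₂ hv₃ hNr hLz hR₀ hℓ₁ hℓ hρf hG₁ hG₂ hG₃ hκ₃F' hKp hwsi hτt hAe1 hAe2 hAn1 hAn2 hAv1 hAv2 rfl rfl rfl rfl rfl hs₀ hs₁ hs₂ hs₃ hs₂ rfl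
    nw hD hdom₀' hdom₁' Y'
  -- the radicand `W ≤ x²·Ŵ` (no finite-volume cut needed)
  have e12 : ρ' / u / (Nr - 1) * (Nr - 1) = ρ' / u := div_mul_cancel₀ _ hNr1.ne'
  have e13 : ρ₃' / u / (Nr - 1) * (Nr - 1) = ρ₃' / u := div_mul_cancel₀ _ hNr1.ne'
  have hrad : 524288 * (1 / s₀ + 1) *
      ((1 + 2 * Real.sqrt 2 * (ρ' / u) / (ρ' / u / (Nr - 1) * (Nr - 1)) + 2 * Real.sqrt 2 * (ρ' / u) / (ρ' / u / (Nr - 1) * (Nr - 1))) ^ 2 *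
          ((2 * Real.sqrt 2 / (ρ' / u / (Nr - 1) * (Nr - 1)) + 2) * (2 * Real.sqrt 2 / (ρ₃' / u / (Nr - 1) * (Nr - 1)) + 2)) +
        (1 / (ρ' / u) + 1) ^ 2 / (1 + ρ' / u * (R₀ : ℝ))) ≤
      u ^ 2 * (524288 * (1 / s₀ + 1) * ((1 + 4 * Real.sqrt 2) ^ 2 * ((2 * Real.sqrt 2 / ρ' + 2) * (2 * Real.sqrt 2 / ρ₃' + 2)) + (1 / ρ' + 1) ^ 2)) := by
    rw [e12, e13, mul_div_cancel_right₀ _ hs₁.ne']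
    have i1 : 2 * Real.sqrt 2 / (ρ' / u) + 2 ≤ u * (2 * Real.sqrt 2 / ρ' + 2) := by
      rw [div_div_eq_mul_div, show u * (2 * Real.sqrt 2 / ρ' + 2) = 2 * Real.sqrt 2 * u / ρ' + 2 * u by ring]
      linarith only [hu1]
    have i2 : 2 * Real.sqrt 2 / (ρ₃' / u) + 2 ≤ u * (2 * Real.sqrt 2 / ρ₃' + 2) := by
      rw [div_div_eq_mul_div, show u * (2 * Real.sqrt 2 / ρ₃' + 2) = 2 * Real.sqrt 2 * u / ρ₃' + 2 * u by ring]
      linarith only [hu1]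
    have i3 : (1 / (ρ' / u) + 1) ^ 2 / (1 + ρ' / u * (R₀ : ℝ)) ≤ u ^ 2 * (1 / ρ' + 1) ^ 2 := by
      have hden : 1 ≤ 1 + ρ' / u * (R₀ : ℝ) := le_add_of_nonneg_right (by positivity)
      calc (1 / (ρ' / u) + 1) ^ 2 / (1 + ρ' / u * (R₀ : ℝ)) ≤ (1 / (ρ' / u) + 1) ^ 2 := div_le_self (by positivity) hden
        _ ≤ u ^ 2 * (1 / ρ' + 1) ^ 2 := by
            rw [← mul_pow]
            apply pow_le_pow_left₀ (by positivity)
            rw [one_div_div, show u * (1 / ρ' + 1) = u / ρ' + u by ring]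
            linarith only [hu1]
    have i12 : (2 * Real.sqrt 2 / (ρ' / u) + 2) * (2 * Real.sqrt 2 / (ρ₃' / u) + 2) ≤
        u ^ 2 * ((2 * Real.sqrt 2 / ρ' + 2) * (2 * Real.sqrt 2 / ρ₃' + 2)) := by
      calc _ ≤ (u * (2 * Real.sqrt 2 / ρ' + 2)) * (u * (2 * Real.sqrt 2 / ρ₃' + 2)) := mul_le_mul i1 i2 (by positivity) (by positivity)
        _ = _ := by ring
    have h1 : 0 ≤ 524288 * (1 / s₀ + 1) := by positivity
    have h2 : 0 ≤ (1 + 2 * Real.sqrt 2 + 2 * Real.sqrt 2) ^ 2 := by positivity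
    calc 524288 * (1 / s₀ + 1) * ((1 + 2 * Real.sqrt 2 + 2 * Real.sqrt 2) ^ 2 *
            ((2 * Real.sqrt 2 / (ρ' / u) + 2) * (2 * Real.sqrt 2 / (ρ₃' / u) + 2)) + (1 / (ρ' / u) + 1) ^ 2 / (1 + ρ' / u * (R₀ : ℝ)))
          ≤ 524288 * (1 / s₀ + 1) * ((1 + 2 * Real.sqrt 2 + 2 * Real.sqrt 2) ^ 2 *
            (u ^ 2 * ((2 * Real.sqrt 2 / ρ' + 2) * (2 * Real.sqrt 2 / ρ₃' + 2))) + u ^ 2 * (1 / ρ' + 1) ^ 2) := by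
          gcongr
      _ = u ^ 2 * (524288 * (1 / s₀ + 1) * ((1 + 4 * Real.sqrt 2) ^ 2 * ((2 * Real.sqrt 2 / ρ' + 2) * (2 * Real.sqrt 2 / ρ₃' + 2)) + (1 / ρ' + 1) ^ 2)) := by ring
  have hsq : Real.sqrt (524288 * (1 / s₀ + 1) *
      ((1 + 2 * Real.sqrt 2 * (ρ' / u) / (ρ' / u / (Nr - 1) * (Nr - 1)) + 2 * Real.sqrt 2 * (ρ' / u) / (ρ' / u / (Nr - 1) * (Nr - 1))) ^ 2 *
          ((2 * Real.sqrt 2 / (ρ' / u / (Nr - 1) * (Nr - 1)) + 2) * (2 * Real.sqrt 2 / (ρ₃' / u / (Nr - 1) * (Nr - 1)) + 2)) +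
        (1 / (ρ' / u) + 1) ^ 2 / (1 + ρ' / u * (R₀ : ℝ)))) ≤
      u * Real.sqrt (524288 * (1 / s₀ + 1) * ((1 + 4 * Real.sqrt 2) ^ 2 * ((2 * Real.sqrt 2 / ρ' + 2) * (2 * Real.sqrt 2 / ρ₃' + 2)) + (1 / ρ' + 1) ^ 2)) := by
    refine (Real.sqrt_le_sqrt hrad).trans_eq ?_
    rw [Real.sqrt_mul (by positivity), Real.sqrt_sq hu0.le]
  -- the amplitude `A₀^Δ(u) ≤ A₀^♯/x²`
  have hB10 : 0 ≤ B₁ := (abs_nonneg _).trans (hB₁ 0)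
  have hB20 : 0 ≤ B₂ := (abs_nonneg _).trans (hB₂ 0)
  have hB30' : 0 ≤ B₃ := (abs_nonneg _).trans (hB₃ 0)
  have hB40 : 0 ≤ B₄ := (abs_nonneg _).trans (hB₄ 0)
  have hK10 : 0 ≤ K₁ := le_trans (norm_nonneg _) (hK₁ 0)
  have hK20 : 0 ≤ K₂ := le_trans (norm_nonneg _) (hK₂ 0)
  have hc : 0 ≤ β * (L : ℝ) ^ 2 := by positivity
  have hA0 : 0 ≤ A := (norm_nonneg _).trans (hA 0 0 (by norm_num))
  have hG₁0 : 0 ≤ G₁ := by rw [hG₁]; positivity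
  have hG₂0 : 0 ≤ G₂ := by rw [hG₂]; positivity
  have hG₃0 : 0 ≤ G₃ := by rw [hG₃]; positivity
  have hDt : 0 < B.Dtmin - 2 * A := by linarith only [hADt]
  have hρf0 : 0 ≤ ρf := by rw [hρf]; have := B.smax_pos; have := B.Dtmin_pos; have := sectorWidth_pos (m + 1); positivity
  have hℓ₁0 : 0 ≤ ℓ₁ := by rw [hℓ₁]; positivity
  have hNr0 : (0:ℝ) ≤ Nr + 1 / 2 := by linarith only [hNr]
  have hℓ0 : 0 ≤ ℓ := by rw [hℓ]; positivity
  have hwsi0 : 0 ≤ wsi := by rw [hwsi]; have := sectorWidth_pos (m + 1); positivity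
  have hKp0 : 0 ≤ Kp := by rw [hKp]; positivity
  have hAe10 : 0 ≤ Ae1 := by rw [hAe1]; positivity
  have hAe20 : 0 ≤ Ae2 := by rw [hAe2]; positivity
  have hAn10 : 0 ≤ An1 := by rw [hAn1]; positivity
  have hAn20 : 0 ≤ An2 := by rw [hAn2]; positivity
  have hAv10 : 0 ≤ Av1 := by rw [hAv1]; positivity
  have hAv20 : 0 ≤ Av2 := by rw [hAv2]; positivity
  have hκA0 : 0 ≤ κA := by rw [hκA]; positivity
  have hκB0 : 0 ≤ κB := by rw [hκB]; positivity
  obtain ⟨sX₁, sX₂, sX₃⟩ := defectX_scale (k1c := (16 * B₁ + 16) * (β * (L : ℝ) ^ 2) / Λ ^ 2) (k2c := (32 * B₂ + 144 * B₁ + 128) * (β * (L : ℝ) ^ 2) / Λ ^ 3)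
    (k3c := (64 * B₃ + 480 * B₂ + 1728 * B₁ + 1536) * (β * (L : ℝ) ^ 2) / Λ ^ 4)
    (k4c := (128 * B₄ + 1408 * B₃ + 7776 * B₂ + 27648 * B₁ + 24576) * (β * (L : ℝ) ^ 2) / Λ ^ 5) (K₁ := K₁) (K₂ := K₂) (K₃s := K₃s')
    (Q₀ := G₀') (Q₁ := Gi₁') (Q₂ := Gi₂) (Q₃ := Gi₃') (x := u)
    (by positivity) (by positivity) (by positivity) (by positivity) hK10 hK20 hK₃s0 hG₀0 hGi₁0 hGi₂0 hGi₃0 hu1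
  have hX₀s0 : 0 ≤ X₀s := by rw [hX₀s]; positivity
  have hX₁s0 : 0 ≤ X₁s := by rw [hX₁s]; positivity
  have hX₂s0 : 0 ≤ X₂s := by rw [hX₂s]; positivity
  have hX₃s0 : 0 ≤ X₃s := by rw [hX₃s]; positivity
  have hamp := sliceDefect_amp_twoScale_le (c₀ := (1 / (β * (L : ℝ) ^ 2)) ^ 2) (Λm := klScale e₀ m) (ℓ₁ := ℓ₁) (ℓ := ℓ) (κA := κA) (κB := κB)
    (Ae1 := Ae1) (Ae2 := Ae2) (An1 := An1) (An2 := An2) (Av1 := Av1) (Av2 := Av2)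
    (X₀ := (16 * B₁ + 16) * (β * (L : ℝ) ^ 2) / Λ ^ 2 * (G₀' / u ^ 2))
    (X₁ := (32 * B₂ + 144 * B₁ + 128) * (β * (L : ℝ) ^ 2) / Λ ^ 3 * (G₀' / u ^ 2) * (K₁ + Gi₁' / u) + (16 * B₁ + 16) * (β * (L : ℝ) ^ 2) / Λ ^ 2 * (Gi₁' / u))
    (X₂ := (64 * B₃ + 480 * B₂ + 1728 * B₁ + 1536) * (β * (L : ℝ) ^ 2) / Λ ^ 4 * (G₀' / u ^ 2) * (K₁ + Gi₁' / u) ^ 2 +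
      (32 * B₂ + 144 * B₁ + 128) * (β * (L : ℝ) ^ 2) / Λ ^ 3 * (Gi₁' / u * (2 * K₁ + Gi₁' / u)) +
      ((32 * B₂ + 144 * B₁ + 128) * (β * (L : ℝ) ^ 2) / Λ ^ 3 * (G₀' / u ^ 2) * (K₂ + Gi₂) + (16 * B₁ + 16) * (β * (L : ℝ) ^ 2) / Λ ^ 2 * Gi₂))
    (X₃ := (128 * B₄ + 1408 * B₃ + 7776 * B₂ + 27648 * B₁ + 24576) * (β * (L : ℝ) ^ 2) / Λ ^ 5 * (G₀' / u ^ 2) * (K₁ + Gi₁' / u) ^ 3 +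
      (64 * B₃ + 480 * B₂ + 1728 * B₁ + 1536) * (β * (L : ℝ) ^ 2) / Λ ^ 4 * (Gi₁' / u * (3 * K₁ ^ 2 + 3 * K₁ * (Gi₁' / u) + (Gi₁' / u) ^ 2)) +
      3 * ((64 * B₃ + 480 * B₂ + 1728 * B₁ + 1536) * (β * (L : ℝ) ^ 2) / Λ ^ 4 * (G₀' / u ^ 2) * ((K₁ + Gi₁' / u) * (K₂ + Gi₂)) +
        (32 * B₂ + 144 * B₁ + 128) * (β * (L : ℝ) ^ 2) / Λ ^ 3 * (K₁ * Gi₂ + Gi₁' / u * K₂ + Gi₁' / u * Gi₂)) +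
      ((32 * B₂ + 144 * B₁ + 128) * (β * (L : ℝ) ^ 2) / Λ ^ 3 * (G₀' / u ^ 2) * (K₃s' * u + Gi₃' * u) + (16 * B₁ + 16) * (β * (L : ℝ) ^ 2) / Λ ^ 2 * (Gi₃' * u)))
    (X₀s := X₀s) (X₁s := X₁s) (X₂s := X₂s) (X₃s := X₃s)
    (Tt := (1 / (β * (L : ℝ) ^ 2)) ^ 2 *
      (1 * ((2 * π / β) ^ 3 * ((128 * B₄ + 1216 * B₃ + 6912 * B₂ + 26112 * B₁ + 24576) * (β * (L : ℝ) ^ 2) / Λ ^ 5 * (G₀' / u ^ 2))) +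
        3 * ((2 * G₁ * |2 * π / β| * 1 / klScale e₀ m) * ((2 * π / β) ^ 2 * ((64 * B₃ + 416 * B₂ + 1600 * B₁ + 1536) * (β * (L : ℝ) ^ 2) / Λ ^ 4 * (G₀' / u ^ 2)))) +
        3 * (((4 * G₂ + 2 * G₁) * (2 * π / β) ^ 2 * 1 / klScale e₀ m ^ 2) * ((2 * π / β) * ((32 * B₂ + 128 * B₁ + 128) * (β * (L : ℝ) ^ 2) / Λ ^ 3 * (G₀' / u ^ 2)))) +
        ((8 * G₃ + 12 * G₂) * |2 * π / β| ^ 3 * 1 / klScale e₀ m ^ 3) * ((16 * B₁ + 16) * (β * (L : ℝ) ^ 2) / Λ ^ 2 * (G₀' / u ^ 2))))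
    (Tts := Tts) (x := u) (ρ := ρ') (ρ₂ := ρ' / (Nr - 1)) (ρ₃ := ρ₃' / (Nr - 1)) (s₀ := s₀) (L := (L : ℝ)) (P := ((2 * M : ℕ) : ℝ))
    (by positivity) hΛm hℓ₁0 hℓ0 hκA0 hκB0 hAe10 hAe20 hAn10 hAn20 hAv10 hAv20 hu1 hρ0 (by positivity) (by positivity) hs₀ hL
    (by have : 0 < M := Nat.pos_of_ne_zero (NeZero.ne M); exact_mod_cast (by omega : 0 < 2 * M))
    hX₀s0 hX₁s0 hX₂s0 hX₃s0 (by rw [hX₀s]; ring) (by rw [hX₁s]; exact sX₁) (by rw [hX₂s]; exact sX₂) (by rw [hX₃s]; exact sX₃) (by rw [hTts]; field_simp)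
  -- rate spelling inside the amplitude: `(ρ'/(Nr−1))/u = ρ'/u/(Nr−1)`
  have er : ρ' / (Nr - 1) / u = ρ' / u / (Nr - 1) := by rw [div_div, div_div, mul_comm]
  have er3 : ρ₃' / (Nr - 1) / u = ρ₃' / u / (Nr - 1) := by rw [div_div, div_div, mul_comm]
  rw [er, er3] at hamp
  rw [← hAΔs] at hamp
  -- nonnegativity of the `u = 1` amplitude (write `Nr − 1 = ν > 0`)
  obtain ⟨ν, hν0, hν⟩ : ∃ ν : ℝ, 0 < ν ∧ Nr - 1 = ν := ⟨Nr - 1, hNr1, rfl⟩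
  have hTts0 : 0 ≤ Tts := by rw [hTts]; positivity
  have hAΔs0 : 0 ≤ AΔs := by rw [hAΔs, hν]; positivity
  have hN0 : 0 ≤ Real.sqrt (24 * (2 * M : ℕ) * (L : ℝ) ^ 2 *
        ((klScale e₀ m * β / π + 1) *
          ((Real.sqrt 2 * L * ((klScale e₀ m + (4 + 4 * A) * ρf ^ 2) / (2 * B.rhomin - 4 * A)) / π + 2) * (Real.sqrt 2 * L * (2 * ρf) / π + 2)))) := Real.sqrt_nonneg _
  have hW0 : 0 ≤ Real.sqrt (524288 * (1 / s₀ + 1) *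
      ((1 + 2 * Real.sqrt 2 * (ρ' / u) / (ρ' / u / (Nr - 1) * (Nr - 1)) + 2 * Real.sqrt 2 * (ρ' / u) / (ρ' / u / (Nr - 1) * (Nr - 1))) ^ 2 *
          ((2 * Real.sqrt 2 / (ρ' / u / (Nr - 1) * (Nr - 1)) + 2) * (2 * Real.sqrt 2 / (ρ₃' / u / (Nr - 1) * (Nr - 1)) + 2)) +
        (1 / (ρ' / u) + 1) ^ 2 / (1 + ρ' / u * (R₀ : ℝ)))) := Real.sqrt_nonneg _
  -- `(Dw'·u)·(√W·√N·A₀^Δ(u)) ≤ Dw'·(√Ŵ·√N·A₀^♯)`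
  have h1 := mul_le_mul_of_nonneg_left hamp (mul_nonneg hW0 hN0)
  have h2 : Real.sqrt (524288 * (1 / s₀ + 1) *
      ((1 + 2 * Real.sqrt 2 * (ρ' / u) / (ρ' / u / (Nr - 1) * (Nr - 1)) + 2 * Real.sqrt 2 * (ρ' / u) / (ρ' / u / (Nr - 1) * (Nr - 1))) ^ 2 *
          ((2 * Real.sqrt 2 / (ρ' / u / (Nr - 1) * (Nr - 1)) + 2) * (2 * Real.sqrt 2 / (ρ₃' / u / (Nr - 1) * (Nr - 1)) + 2)) +
        (1 / (ρ' / u) + 1) ^ 2 / (1 + ρ' / u * (R₀ : ℝ)))) * Real.sqrt (24 * (2 * M : ℕ) * (L : ℝ) ^ 2 *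
        ((klScale e₀ m * β / π + 1) *
          ((Real.sqrt 2 * L * ((klScale e₀ m + (4 + 4 * A) * ρf ^ 2) / (2 * B.rhomin - 4 * A)) / π + 2) * (Real.sqrt 2 * L * (2 * ρf) / π + 2)))) * (AΔs / u ^ 2) ≤ (u * Real.sqrt (524288 * (1 / s₀ + 1) * ((1 + 4 * Real.sqrt 2) ^ 2 * ((2 * Real.sqrt 2 / ρ' + 2) * (2 * Real.sqrt 2 / ρ₃' + 2)) + (1 / ρ' + 1) ^ 2))) * Real.sqrt (24 * (2 * M : ℕ) * (L : ℝ) ^ 2 *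
        ((klScale e₀ m * β / π + 1) *
          ((Real.sqrt 2 * L * ((klScale e₀ m + (4 + 4 * A) * ρf ^ 2) / (2 * B.rhomin - 4 * A)) / π + 2) * (Real.sqrt 2 * L * (2 * ρf) / π + 2)))) * (AΔs / u ^ 2) :=
    mul_le_mul_of_nonneg_right (mul_le_mul_of_nonneg_right hsq hN0) (by positivity)
  have e : Dw' * u * ((u * Real.sqrt (524288 * (1 / s₀ + 1) * ((1 + 4 * Real.sqrt 2) ^ 2 * ((2 * Real.sqrt 2 / ρ' + 2) * (2 * Real.sqrt 2 / ρ₃' + 2)) + (1 / ρ' + 1) ^ 2))) * Real.sqrt (24 * (2 * M : ℕ) * (L : ℝ) ^ 2 *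
        ((klScale e₀ m * β / π + 1) *
          ((Real.sqrt 2 * L * ((klScale e₀ m + (4 + 4 * A) * ρf ^ 2) / (2 * B.rhomin - 4 * A)) / π + 2) * (Real.sqrt 2 * L * (2 * ρf) / π + 2)))) * (AΔs / u ^ 2)) = Dw' * (Real.sqrt (524288 * (1 / s₀ + 1) * ((1 + 4 * Real.sqrt 2) ^ 2 * ((2 * Real.sqrt 2 / ρ' + 2) * (2 * Real.sqrt 2 / ρ₃' + 2)) + (1 / ρ' + 1) ^ 2)) * Real.sqrt (24 * (2 * M : ℕ) * (L : ℝ) ^ 2 *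
        ((klScale e₀ m * β / π + 1) *
          ((Real.sqrt 2 * L * ((klScale e₀ m + (4 + 4 * A) * ρf ^ 2) / (2 * B.rhomin - 4 * A)) / π + 2) * (Real.sqrt 2 * L * (2 * ρf) / π + 2)))) * AΔs) := by
    field_simp
  have key := (mul_le_mul_of_nonneg_left (h1.trans h2) (by positivity : 0 ≤ Dw' * u)).trans_eq e
  refine ⟨fun Y => (hrows Y).trans ?_, fun Y' => (hcols Y').trans ?_⟩
  · exact mul_le_mul_of_nonneg_left (mul_le_mul_of_nonneg_left key (by norm_num)) (by norm_num)
  · exact mul_le_mul_of_nonneg_left (mul_le_mul_of_nonneg_left key (by norm_num)) (by norm_num)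

end CovPieceTel

end Summit.HubbardSuperconductivity.HubbardSuperconductivity.Theorems.TorusFourierL2

end
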